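import Summits.QuantumFields.BalabanUV.T4Continuum.Spine.NE9.DirectPairingLocality

/-!
# T⁴ programme, spine estimate NE9 — KING'S CURRENCY, THE LAST UNIFORMITY: over the RUNS at a fixed scale and shape the
# per-shape modulus of `DirectPairingLocality` is an INFINITE-VOLUME uniformity (the domains of one shape and scale born in
# later runs live on larger tori); it is FREE from per-run joint continuity + STABILISATION of the local term as the run index
# grows, uniformly on compact local data (the eventually-constant case is exact locality) — census item C35 of cell
# `pub-balaban-gaps`, seat ne9 (gen 8); the necessity half is the companion file `DirectPairingRunLimitSharp`

Cell `pub-balaban-gaps` (YM blitz G2, seat ne9, unit `pub-balaban-gaps-ne9-g8`; record `run/shared/lean/pub/pub-balaban-gaps/ne/NE9.md` §5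
row C35).  Summits-side bookkeeping; real analysis on hypothesis SHAPES over gen 4's `TowerCarriers.TowerData`; no definition; nothing of
Bałaban's asserted.

WHY.  Gen 7 (`DirectPairingLocality`, C34) reduced the uniformity clause inside the King-currency input of NE9-as-consumed to: per scale
`m` and SHAPE `σ`, ONE modulus serving every run `k`, background `U` and domain `X` of that shape and scale (`hUCσ` of `sepUC_of_shapes`),
and discharged it from LOCALITY + COMPACTNESS + JOINT CONTINUITY when the normalised term factors through ONE run-independent function
`Em` (`sepUCshape_of_compact`) — leaving as «printed KIND, unprinted LETTER» the run-independence of the local term at a fixed shape.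
WHAT THAT RESIDUE IS: in the tower of carriers a domain `X` born in run `r X` has scale `m` in run `k = r X + m`, where the current
unit lattice is a torus of `L^{r X}` sites a side — so at FIXED scale and shape the runs enumerate TORI OF INCREASING SIZE, and the
clause is a uniformity IN THE VOLUME of a qualitative modulus.  Print gives volume-uniform BOUNDS ([Balaban1987RG1] Thm 1 p. 259
*"uniformly in the lattice spacing"*; for `β`, p. 264, *"uniformly bounded on this interval together with all derivatives"*), not
convergence of RG objects along a sequence of tori — a step flagged as non-routine in print for scalar models ([Dimock2009Dipole] p. 2:
*"One obtains bounds on the partition function and correlation functions uniform in N. … The N → ∞ limit would be awkward for a sequence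
of tori because the N dependence appears in the covariance C as well as the interaction. Furthermore for the tori there are difficulties
connected with the change in topology."*).  This file types the sufficient sources:
* §1 `equiUC_of_stabilising` — a run-indexed family of maps, each uniformly continuous on a set, which STABILISES (uniformly Cauchy in
  the run index on that set) is uniformly EQUICONTINUOUS there (ε∕3 + a finite minimum, `DirectPairingPropagationCarriers.exists_common_delta`).
* §2 **`sepUCshape_of_stabilising`** — per shape and scale: factorisation of the normalised term through compact local data with a
  RUN-INDEXED jointly continuous `Em k` on the closed cube × `Kc` (Heine–Cantor per run) + stabilisation of `k ↦ Em k` uniformly on that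
  compact ⇒ the per-shape modulus `hUCσ` (same conclusion as gen 7's `sepUCshape_of_compact`, whose single `Em` is the constant family:
  `stabilising_of_eventuallyEq` covers EXACT LOCALITY — the term intrinsic to a neighbourhood of the domain once the torus exceeds it,
  eventually constant in the run; gen 7's theorem is the constant family `fun _ => Em` with `stabilising_of_eventuallyEq … ⟨0, …⟩`, not restated here — the gate's dedup rule — so C35 ⊇ C34 §3).
* §3 **`king_U6_of_stabilising_shapes`** — the King-currency END BY NAME at `κ' < κ` (`DirectPairingLocality.king_U6_of_shapes`) from
  tower-NE5 + prefix dependence + the bound + (S) + (K) + per shape∕scale: compact local data, per-run joint continuity, stabilisation.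
NECESSITY (companion `DirectPairingRunLimitSharp`): a tower satisfying tower-NE5, prefix dependence, the bound, every PER-RUN modulus and
the per-run factorisation, on which the conclusion of `TowerCarriersKing.directBracket_eventually_le_carriers` itself FAILS — the
run-uniformity cannot be dropped.

VERDICT FOR THE ROW (bookkeeping).  The last uniformity inside the King-currency account of NE9-as-consumed — over the RUNS at fixed
scale and shape — is a VOLUME-uniformity of a qualitative modulus; it is supplied by ANY ONE of: (a) exact locality of the localized
term (eventually run-independent; READING of [Balaban1988RG2Cluster] (1.34)∕(2.14)), (b) stabilisation of the fixed-scale local term as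
the torus grows (thermodynamic-limit KIND; NOT PRINTED for Bałaban's step, cf. [Dimock2009Dipole] p. 2), (c) a volume-uniform
quantitative modulus in the young couplings (printed KIND: [Balaban1987RG1] p. 264 for `β`; for `E^{(j)}` p. 263 has C^∞ without stated
uniformity) — each a property of ONE renormalization step's localized output on tori of all sizes, i.e. of W1's object.  Classification
of NE9 UNCHANGED in kind (WORK-bound on W1; instance 0∕1).

HONEST FRAMING: bookkeeping for rung (B)+1 on ONE FIXED finite four-torus (the growing tori are the FIXED torus in the units of finer
RG scales — no infinite-volume claim is made or needed); (L)(S) and the local data are abstract (`sh`, `Kc`, `loc`, `Em`), not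
constructed for Bałaban's domains; tower-NE5 is the cell's estimate NE5 (NOT PRINTED, NOT PROVED); NE9 NOT PRINTED ∕ NOT PROVED;
spine PROVED 0∕9 unchanged; NOT UV stability, NOT the continuum limit, NOT infinite volume, NOT a mass gap, NOT Clay.

References (TYPES only): [Balaban1987RG1] = T. Bałaban, Commun. Math. Phys. **109** (1987) 249–301, Thm 1 p. 259, (1.7) p. 261, p. 263,
p. 264; [Balaban1988RG2Cluster] = T. Bałaban, Commun. Math. Phys. **116** (1988) 1–22, (1.34) p. 9, (2.14) p. 15; [Dimock2009Dipole] =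
J. Dimock, *Infinite volume limit for the dipole gas*, J. Stat. Phys. **135** (2009) 393–427 (arXiv:0812.1765), §1.1 p. 2; [King1986] =
C. King, Commun. Math. Phys. **102** (1986) 649–677, §3.2 pp. 656–657.
-/

namespace Summit.QuantumFields.BalabanUV.T4Continuum.NE9.DirectPairingRunLimit

open scoped BigOperators
open Finset Filter Topology Metric Set
open Literature.MathematicalPhysics.QuantumFieldTheory.Balaban1983to89
open Literature.MathematicalPhysics.QuantumFieldTheory.Balaban1983to89.T4CouplingAnalyticity (BoxWindow)
open T4CauchySum (delta)
open Summit.QuantumFields.BalabanUV.T4Continuum.NE9.TowerCarriers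
open Summit.QuantumFields.BalabanUV.T4Continuum.NE9.TowerCarriersBox (TowerNE5On)
open Summit.QuantumFields.BalabanUV.T4Continuum.NE9.DirectPairingPropagationCarriers (exists_common_delta)
open Summit.QuantumFields.BalabanUV.T4Continuum.NE9.DirectPairingLocality (king_U6_of_shapes)

/-! ## §1 A stabilising family of uniformly continuous maps is uniformly equicontinuous -/

/-- **STABILISATION + PER-INDEX UNIFORM CONTINUITY ⇒ UNIFORM EQUICONTINUITY.**  A family `f k`, `k ∈ ℕ`, of maps each uniformly
continuous on a set `S` (`huc`, one modulus per `k`) which STABILISES on `S` — for every `ε > 0` some `K₀` with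
`dist (f k x) (f K₀ x) ≤ ε` for all `k ≥ K₀`, `x ∈ S` (uniformly Cauchy in the index) — has ONE modulus serving every `k`: the
finitely many `k ≤ K₀` share a finite minimum, the later ones borrow `f K₀`'s (ε∕3).  The direction «convergent ⇒ equicontinuous»
of Arzelà–Ascoli, in the elementary form used here. [folklore] -/
theorem equiUC_of_stabilising {α β : Type*} [PseudoMetricSpace α] [PseudoMetricSpace β] {S : Set α} {f : ℕ → α → β}
    (huc : ∀ k, ∀ ε : ℝ, 0 < ε → ∃ δ : ℝ, 0 < δ ∧ ∀ x ∈ S, ∀ y ∈ S, dist x y ≤ δ → dist (f k x) (f k y) ≤ ε)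
    (hstab : ∀ ε : ℝ, 0 < ε → ∃ K₀ : ℕ, ∀ k, K₀ ≤ k → ∀ x ∈ S, dist (f k x) (f K₀ x) ≤ ε) :
    ∀ ε : ℝ, 0 < ε → ∃ δ : ℝ, 0 < δ ∧ ∀ k, ∀ x ∈ S, ∀ y ∈ S, dist x y ≤ δ → dist (f k x) (f k y) ≤ ε := by
  intro ε hε
  obtain ⟨K₀, hK₀⟩ := hstab (ε / 3) (by positivity)
  obtain ⟨δ, hδ, hF⟩ := exists_common_delta (range (K₀ + 1))
    (fun k δ => ∀ x ∈ S, ∀ y ∈ S, dist x y ≤ δ → dist (f k x) (f k y) ≤ ε / 3)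
    (fun k δ δ' hle h x hx y hy hxy => h x hx y hy (hxy.trans hle))
    (fun k _ => huc k (ε / 3) (by positivity))
  refine ⟨δ, hδ, fun k x hx y hy hxy => ?_⟩
  rcases le_or_gt k K₀ with hk | hk
  · exact (hF k (mem_range.2 (by omega)) x hx y hy hxy).trans (by linarith)
  · have h1 : dist (f k x) (f K₀ x) ≤ ε / 3 := hK₀ k hk.le x hx
    have h2 : dist (f K₀ x) (f K₀ y) ≤ ε / 3 := hF K₀ (mem_range.2 (by omega)) x hx y hy hxy
    have h3 : dist (f K₀ y) (f k y) ≤ ε / 3 := by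
      rw [dist_comm]; exact hK₀ k hk.le y hy
    calc dist (f k x) (f k y) ≤ dist (f k x) (f K₀ x) + dist (f K₀ x) (f K₀ y) + dist (f K₀ y) (f k y) :=
        dist_triangle4 _ _ _ _
      _ ≤ ε := by linarith

/-! ## §2 Per shape: compact local data + per-run joint continuity + stabilisation in the run ⇒ the uniform modulus -/

variable (T : TowerData) {E : ℕ → (ℕ → ℝ) → T.B → T.Dom → ℝ} {I : Set ℝ} {κ κ' : ℝ}

/-- **THE PER-SHAPE MODULUS FROM LOCALITY + COMPACTNESS + PER-RUN JOINT CONTINUITY + STABILISATION.**  Fix a shape `σ` and a scale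
`m`.  Suppose that for every run `k`, background `U` and domain `X` of that shape and scale the normalised term FACTORS as
`e^{κd(X)}·E k g U X = Em k (g|_{<m}) (loc k U X)` through a local datum in a COMPACT set `Kc`, with a RUN-INDEXED `Em k` each
JOINTLY CONTINUOUS on `[a, b]^m × Kc` (young couplings on the CLOSED cube, [Balaban1987RG1] p. 263) — so far gen 7's hypotheses run
by run — and that `k ↦ Em k` STABILISES uniformly on that compact (`hstab`: the fixed-scale local term of this shape settles as the
run index, i.e. the torus, grows; exact locality = eventually constant is the special case `stabilising_of_eventuallyEq`).  Then ONE
`δ` serves every run, background and domain of shape `σ` and scale `m` on every sub-box `BoxWindow J`, `J ⊆ [a, b]`: the per-shape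
hypothesis `hUCσ` of `DirectPairingLocality.sepUC_of_shapes`. [folklore] -/
theorem sepUCshape_of_stabilising {Sh : Type*} (sh : T.Dom → Sh) (σ : Sh) (m : ℕ) {L : Type*} [PseudoMetricSpace L]
    {Kc : Set L} (hKc : IsCompact Kc) {a b : ℝ} {J : Set ℝ} (hJ : J ⊆ Icc a b) (Em : ℕ → (Fin m → ℝ) → L → ℝ)
    (hcont : ∀ k, ContinuousOn (fun p : (Fin m → ℝ) × L => Em k p.1 p.2) ((Set.univ.pi fun _ => Icc a b) ×ˢ Kc))
    (hstab : ∀ ε : ℝ, 0 < ε → ∃ K₀ : ℕ, ∀ k, K₀ ≤ k →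
      ∀ p ∈ (Set.univ.pi fun _ : Fin m => Icc a b) ×ˢ Kc, |Em k p.1 p.2 - Em K₀ p.1 p.2| ≤ ε)
    (loc : ℕ → T.B → T.Dom → L)
    (hfac : ∀ (k : ℕ) (U : T.B) (X : T.Dom), sh X = σ → T.r X + m = k → loc k U X ∈ Kc ∧
      ∀ g ∈ BoxWindow J, Real.exp (κ * T.d X) * E k g U X = Em k (fun l => g l) (loc k U X)) :
    ∀ (i : ℕ) (ε : ℝ), 0 < ε → ∃ δ : ℝ, 0 < δ ∧ ∀ (k : ℕ) (U : T.B) (X : T.Dom), sh X = σ → T.r X + m = k →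
      ∀ g ∈ BoxWindow J, ∀ g' ∈ BoxWindow J, (∀ j, j ≠ i → g j = g' j) → |g i - g' i| ≤ δ →
        Real.exp (κ * T.d X) * |E k g U X - E k g' U X| ≤ ε := by
  intro i ε hε
  set S : Set ((Fin m → ℝ) × L) := (Set.univ.pi fun _ : Fin m => Icc a b) ×ˢ Kc with hS
  have hC : IsCompact S := (isCompact_univ_pi fun _ => isCompact_Icc).prod hKc
  -- per run: Heine–Cantor on the compact product
  have huc : ∀ k, ∀ ε : ℝ, 0 < ε → ∃ δ : ℝ, 0 < δ ∧ ∀ x ∈ S, ∀ y ∈ S, dist x y ≤ δ →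
      dist ((fun (k : ℕ) (p : (Fin m → ℝ) × L) => Em k p.1 p.2) k x)
        ((fun (k : ℕ) (p : (Fin m → ℝ) × L) => Em k p.1 p.2) k y) ≤ ε :=
    fun k ε hε => Metric.uniformContinuousOn_iff_le.1 (hC.uniformContinuousOn_of_continuous (hcont k)) ε hε
  have hstab' : ∀ ε : ℝ, 0 < ε → ∃ K₀ : ℕ, ∀ k, K₀ ≤ k → ∀ x ∈ S,
      dist ((fun (k : ℕ) (p : (Fin m → ℝ) × L) => Em k p.1 p.2) k x)
        ((fun (k : ℕ) (p : (Fin m → ℝ) × L) => Em k p.1 p.2) K₀ x) ≤ ε := by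
    intro ε hε
    obtain ⟨K₀, h⟩ := hstab ε hε
    exact ⟨K₀, fun k hk x hx => by rw [Real.dist_eq]; exact h k hk x hx⟩
  obtain ⟨δ, hδ, h⟩ := equiUC_of_stabilising huc hstab' ε hε
  refine ⟨δ, hδ, fun k U X hX hk g hg g' hg' hagree hdiff => ?_⟩
  obtain ⟨hloc, hE⟩ := hfac k U X hX hk
  have hcube : ∀ h : ℕ → ℝ, h ∈ BoxWindow J → (fun l : Fin m => h l) ∈ Set.univ.pi fun _ : Fin m => Icc a b :=
    fun h hh l _ => hJ (hh l)
  have hmem : ((fun l : Fin m => g l), loc k U X) ∈ S := ⟨hcube g hg, hloc⟩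
  have hmem' : ((fun l : Fin m => g' l), loc k U X) ∈ S := ⟨hcube g' hg', hloc⟩
  have hdist : dist ((fun l : Fin m => g l), loc k U X) ((fun l : Fin m => g' l), loc k U X) ≤ δ := by
    rw [Prod.dist_eq, dist_self]
    refine max_le ((dist_pi_le_iff hδ.le).2 fun l => ?_) hδ.le
    show dist (g l) (g' l) ≤ δ
    by_cases hl : (l : ℕ) = i
    · rw [Real.dist_eq, hl]; exact hdiff
    · rw [hagree l hl, dist_self]; exact hδ.le
  have key := h k _ hmem _ hmem' hdist
  dsimp only at key
  rw [Real.dist_eq, ← hE g hg, ← hE g' hg', ← mul_sub, abs_mul, abs_of_pos (Real.exp_pos _)] at key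
  exact key

/-- **EXACT LOCALITY IS THE EVENTUALLY-CONSTANT CASE**: if from some run on the run-indexed local functions agree on the set (the
localized term is intrinsic to a neighbourhood of the domain once the torus exceeds it — READING of [Balaban1988RG2Cluster] (1.34)
p. 9, [Balaban1987RG1] (1.7) p. 261), the family stabilises. [folklore] -/
theorem stabilising_of_eventuallyEq {m : ℕ} {L : Type*} {S : Set ((Fin m → ℝ) × L)} (Em : ℕ → (Fin m → ℝ) → L → ℝ)
    (h : ∃ k₀ : ℕ, ∀ k, k₀ ≤ k → ∀ p ∈ S, Em k p.1 p.2 = Em k₀ p.1 p.2) :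
    ∀ ε : ℝ, 0 < ε → ∃ K₀ : ℕ, ∀ k, K₀ ≤ k → ∀ p ∈ S, |Em k p.1 p.2 - Em K₀ p.1 p.2| ≤ ε := by
  intro ε hε
  obtain ⟨k₀, hk₀⟩ := h
  exact ⟨k₀, fun k hk p hp => by rw [hk₀ k hk p hp, sub_self, abs_zero]; exact hε.le⟩

/-! ## §3 Node U6 in King's currency from per-run continuity + stabilisation, BY NAME -/

/-- **NODE U6 IN KING'S CURRENCY FROM STABILISING LOCAL TERMS** (`DirectPairingLocality.king_U6_of_shapes` BY NAME at `κ' < κ`):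
tower-NE5 at `κ` + prefix dependence + the (1.18)-type bound + finitely many shapes below every tree length + per shape `σ` and
scale `m`: a compact set `Kc σ m` of local data, a run-indexed family `Em σ m k` jointly continuous on `[a, b]^m × Kc σ m` (`I ⊆ [a, b]`)
which stabilises in the run, and the factorisation of the normalised term through it + node U2's summable consecutive profile ⇒ a
scale profile `b_j → 0` dominating the direct bracket of the runs `K`, `K + n` at every background and domain in the weight `e^{−κ'd}`,
and `T4CauchySum.delta E₀ ρ inj K → 0` for every injection under it.  E-side inputs: tower-NE5, locality (compact local data), per-run
joint continuity, stabilisation in the run, (S), (B), (K) — NO modulus, NO constant, NO uniformity clause. [folklore] -/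
theorem king_U6_of_stabilising_shapes {θ C₅ B : ℝ} {p : ℕ → ℝ} {t : ℕ → ℕ → ℝ} {Sh : Type*} (sh : T.Dom → Sh)
    (dS : Sh → ℝ) (hd : ∀ X, T.d X = dS (sh X)) (hfin : ∀ D : ℝ, {σ | dS σ ≤ D}.Finite)
    (hC : 0 ≤ C₅) (hθ0 : 0 ≤ θ) (hθ1 : θ < 1) (hκ : κ' < κ) (h5 : TowerNE5On T E I κ θ C₅)
    (hP : ∀ (k : ℕ) (U : T.B) (X : T.Dom), ∀ g ∈ BoxWindow I, ∀ g' ∈ BoxWindow I,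
      (∀ i, i < k - T.r X → g i = g' i) → E k g U X = E k g' U X)
    (hB0 : 0 ≤ B) (hB : ∀ (k : ℕ) (U : T.B) (X : T.Dom), ∀ g ∈ BoxWindow I, Real.exp (κ * T.d X) * |E k g U X| ≤ B)
    {L : Type*} [PseudoMetricSpace L] (Kc : Sh → ℕ → Set L) (hKc : ∀ σ m, IsCompact (Kc σ m)) {a b : ℝ}
    (hI : I ⊆ Icc a b) (Em : (σ : Sh) → (m : ℕ) → ℕ → (Fin m → ℝ) → L → ℝ)
    (hcont : ∀ σ m k, ContinuousOn (fun q : (Fin m → ℝ) × L => Em σ m k q.1 q.2) ((Set.univ.pi fun _ => Icc a b) ×ˢ Kc σ m))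
    (hstab : ∀ σ m, ∀ ε : ℝ, 0 < ε → ∃ K₀ : ℕ, ∀ k, K₀ ≤ k →
      ∀ q ∈ (Set.univ.pi fun _ : Fin m => Icc a b) ×ˢ Kc σ m, |Em σ m k q.1 q.2 - Em σ m K₀ q.1 q.2| ≤ ε)
    (loc : ℕ → T.B → T.Dom → L)
    (hfac : ∀ (σ : Sh) (m k : ℕ) (U : T.B) (X : T.Dom), sh X = σ → T.r X + m = k → loc k U X ∈ Kc σ m ∧
      ∀ g ∈ BoxWindow I, Real.exp (κ * T.d X) * E k g U X = Em σ m k (fun l => g l) (loc k U X))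
    (ht : ∀ K, t K ∈ BoxWindow I) (hp : ∀ K i, |t (K + 1) (i + 1) - t K i| ≤ p i) (hp0 : ∀ i, 0 ≤ p i) (hps : Summable p) :
    ∃ b : ℕ → ℝ, (∀ j, 0 ≤ b j) ∧ Tendsto b atTop (𝓝 0) ∧
      (∀ (K n : ℕ) (U : T.B) (X : T.Dom), T.r X ≤ K →
        |E (K + n) (t (K + n)) U X - E K (t K) (T.descend (K + n) U K) X| ≤ b (K - T.r X) * Real.exp (-(κ' * T.d X))) ∧
      ∀ (E₀ ρ : ℝ) (inj : ℕ → ℕ → ℝ), 0 ≤ E₀ → 0 ≤ ρ → ρ < 1 →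
        (∀ K j : ℕ, j ≤ K → 0 ≤ inj K j ∧ inj K j ≤ b j) → Tendsto (delta E₀ ρ inj) atTop (𝓝 0) :=
  king_U6_of_shapes T sh dS hd hfin hC hθ0 hθ1 hκ h5 hP hB0 hB
    (fun σ m i _ ε hε => sepUCshape_of_stabilising T sh σ m (hKc σ m) hI (Em σ m) (hcont σ m) (hstab σ m) loc
      (hfac σ m) i ε hε)
    ht hp hp0 hps

/-! ## §4 (appended 2026-08-23, same seat) The same one level down, for ONE STEP: per-run joint continuity of the step on (closed
coupling interval × compact class) + STABILISATION of the step as the run index (the torus) grows ⇒ the run-uniform step clauses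
[UC-OLD] ∕ [UC-LAST] of `DirectPairingPropagation.propagate` (C33) — the primitive, W1-level form of C35: the thermodynamic limit of
ONE renormalization step on local data of a fixed shape -/

/-- **[UC-OLD] AND [UC-LAST] UNIFORMLY OVER THE RUNS, FROM PER-RUN JOINT CONTINUITY + STABILISATION OF THE STEP.**  A run-indexed family
of steps `Φ s j : ℝ → S → S` (`s` = the run, i.e. the torus size at scale `j`), each JOINTLY CONTINUOUS on the compact `I ×ˢ K j` (closed
coupling interval, [Balaban1987RG1] p. 263, × compact class — gen 7's `DirectPairingPropagation.sepUC_hyps_of_compact` RUN BY RUN), which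
STABILISES in the run uniformly on `I ×ˢ K j` (`hstab`), satisfies BOTH step clauses of `DirectPairingPropagation.propagate` with ONE `δ` for
all runs: `hold` (uniform continuity in the old datum) and `hlast` (in the last coupling).  Proof: `equiUC_of_stabilising` on the product.
So C33's «uniformly over the runs» is, like C35's, a volume-uniformity supplied by stabilisation (or exact locality, or a volume-uniform
quantitative modulus) of the ONE-STEP map — W1's object. [folklore] -/
theorem stepUC_of_stabilising {S : Type*} [PseudoMetricSpace S] {I : Set ℝ} (hI : IsCompact I) {K : ℕ → Set S}
    (hK : ∀ j, IsCompact (K j)) (Φ : ℕ → ℕ → ℝ → S → S)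
    (hcont : ∀ s j, ContinuousOn (fun p : ℝ × S => Φ s j p.1 p.2) (I ×ˢ K j))
    (hstab : ∀ j, ∀ ε : ℝ, 0 < ε → ∃ s₀ : ℕ, ∀ s, s₀ ≤ s → ∀ p ∈ I ×ˢ K j, dist (Φ s j p.1 p.2) (Φ s₀ j p.1 p.2) ≤ ε) :
    (∀ j, ∀ ε : ℝ, 0 < ε → ∃ δ : ℝ, 0 < δ ∧ ∀ s, ∀ c ∈ I, ∀ w ∈ K j, ∀ w' ∈ K j,
        dist w w' ≤ δ → dist (Φ s j c w) (Φ s j c w') ≤ ε) ∧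
      ∀ j, ∀ ε : ℝ, 0 < ε → ∃ δ : ℝ, 0 < δ ∧ ∀ s, ∀ w ∈ K j, ∀ c ∈ I, ∀ c' ∈ I,
        |c - c'| ≤ δ → dist (Φ s j c w) (Φ s j c' w) ≤ ε := by
  have key : ∀ j, ∀ ε : ℝ, 0 < ε → ∃ δ : ℝ, 0 < δ ∧ ∀ s, ∀ x ∈ I ×ˢ K j, ∀ y ∈ I ×ˢ K j, dist x y ≤ δ →
      dist ((fun (s : ℕ) (p : ℝ × S) => Φ s j p.1 p.2) s x) ((fun (s : ℕ) (p : ℝ × S) => Φ s j p.1 p.2) s y) ≤ ε := by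
    intro j
    refine equiUC_of_stabilising (fun s ε hε => ?_) (fun ε hε => ?_)
    · exact Metric.uniformContinuousOn_iff_le.1 ((hI.prod (hK j)).uniformContinuousOn_of_continuous (hcont s j)) ε hε
    · obtain ⟨s₀, h⟩ := hstab j ε hε
      exact ⟨s₀, fun s hs x hx => h s hs x hx⟩
  refine ⟨fun j ε hε => ?_, fun j ε hε => ?_⟩
  · obtain ⟨δ, hδ, h⟩ := key j ε hε
    refine ⟨δ, hδ, fun s c hc w hw w' hw' hww' => ?_⟩
    have h1 := h s (c, w) ⟨hc, hw⟩ (c, w') ⟨hc, hw'⟩ (by rw [Prod.dist_eq, dist_self]; exact max_le hδ.le hww')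
    dsimp only at h1
    exact h1
  · obtain ⟨δ, hδ, h⟩ := key j ε hε
    refine ⟨δ, hδ, fun s w hw c hc c' hc' hcc' => ?_⟩
    have h1 := h s (c, w) ⟨hc, hw⟩ (c', w) ⟨hc', hw⟩ (by rw [Prod.dist_eq, dist_self, Real.dist_eq]; exact max_le hcc' hδ.le)
    dsimp only at h1
    exact h1

end Summit.QuantumFields.BalabanUV.T4Continuum.NE9.DirectPairingRunLimit
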